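import Literature.NumberTheory.QuadraticForms.HasseNormTheoremHolds
import HarnessLib

/-!
# The embedding criterion for quadratic fields (Vignéras III §3 Thm. 3.8 (1)) — unconditionally

Discharge file of `QuaternionAlgebraEmbedding` (namespace `Literature.NumberTheory.Automorphic`)
for its named fact `exists_sq_eq_of_not_isSquare_ramified K D` (Vignéras, LNM 800, Ch. III §3
Thm. 3.8, first assertion: *Pour qu'une extension quadratique `L/K` se plonge dans une algèbre de
quaternions `H`, il faut et il suffit que `L_v` soit un corps, si `v ∈ Ram(H)`* — sufficiency, for
`L = K(√a)`, `a ∉ K²`; PDF p. 68 of the held copy).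

Pure assembly of results already proved in the tree, along the book's route through Cor. 3.5
(*caractérisation des corps neutralisants*) and Cor. 3.4 (*théorème des normes dans les
extensions quadratiques*):

* `exists_sq_eq_of_not_isSquare_ramified_of_facts` (`QuaternionAlgebraEmbeddingProofs`) proves
  Thm. 3.8 (1) from the local norm index `(K_vˣ : N(K_v(√x)ˣ)) = 2` at the finite places ramified
  in `D` and from Hasse's norm theorem for the quadratic extensions of `K`;
* `Literature.NumberTheory.QuadraticForms.exists_sq_eq_of_not_isSquare_ramified_of_hasseNorm`
  (`QuadraticForms/LocalNormIndex`) supplies the local norm index at every place, dyadic places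
  included (O'Meara 63:13a, proved by counting square classes), leaving Hasse's norm theorem as
  the only hypothesis;
* `hilbertSymbol_eq_one_of_forall_completions_holds` (`QuadraticForms/HasseNormTheoremHolds`) is
  Hasse's norm theorem for quadratic extensions of number fields (Vignéras III Cor. 3.4 = O'Meara
  65:23), proved along O'Meara §65 (unit norm index 65:10, `unitNormIndex_holds`).

This file cannot be merged into `QuaternionAlgebraEmbedding.lean` or
`QuaternionAlgebraEmbeddingProofs.lean`: both are imported (transitively) by
`HasseNormTheoremHolds`. All declarations here are theorems.

## References

* M.-F. Vignéras, *Arithmétique des algèbres de quaternions*, LNM 800 (1980), Ch. III §3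
  Cor. 3.4, Cor. 3.5, Thm. 3.8 (PDF pp. 66–68 of the held copy).
* O. T. O'Meara, *Introduction to quadratic forms*, Grundlehren 117, Springer (1963), §63B
  63:13a, §65D 65:23.
-/

noncomputable section

namespace Literature.NumberTheory.Automorphic

universe u

variable (K : Type) [Field K] [NumberField K] (D : Type u) [Ring D] [Algebra K D]

/-- **Vignéras III §3 Thm. 3.8, first assertion, holds** (the named fact
`exists_sq_eq_of_not_isSquare_ramified K D` of `QuaternionAlgebraEmbedding`): for a quaternion
algebra `D` over a number field `K` and `a ∉ K²` which is a non-square in `K_v` for every finite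
place `v` ramified in `D` and in `K_w` for every infinite place `w` ramified in `D`, some `x ∈ D`
satisfies `x² = a`, i.e. `K(√a) ↪ D`. Proof: `exists_sq_eq_of_not_isSquare_ramified_of_hasseNorm`
(Thm. 3.8 (1) from Hasse's norm theorem over the quadratic extensions of `K`, the local norm
indices being proved) fed with `hilbertSymbol_eq_one_of_forall_completions_holds` (Cor. 3.4,
proved). [cite: VignerasLNM800, Ch. III §3 Thm. 3.8] -/
theorem exists_sq_eq_of_not_isSquare_ramified_holds : exists_sq_eq_of_not_isSquare_ramified K D :=
  Literature.NumberTheory.QuadraticForms.exists_sq_eq_of_not_isSquare_ramified_of_hasseNorm K D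
    fun L _ _ _ c d ↦ hilbertSymbol_eq_one_of_forall_completions_holds L c d

end Literature.NumberTheory.Automorphic
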